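import Mathlib.Algebra.BigOperators.Group.Finset.Basic
import Mathlib.Tactic.Linarith
import Mathlib.Tactic.NormNum
import Mathlib.Tactic.Ring
import Mathlib.Tactic.Positivity
import HarnessLib

/-!
# The (0,1) cell of the ι-window, XXXVIII: the product ground `B₁ × B₂`, XXV — THE CORNER X, THE RIGID SKELETON
# (report [XXXVIII] `H2-ZERO-ONE-38.md`): arithmetic shadows of LEMMA NORM, LEMMA NO-β1, PROPOSITION FAT-THETA, LEMMA CROSS,
# THEOREM THETA-CAP and THEOREM H′-ZERO (the five cells `(7, d₃, 21, d₃)`, `d₃ = 10, …, 14`, carry no (0,1) object modulo [XXXVII])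

Family `hodge`, b2b cell `hweil` (helper of item stmt-HodgeConjecture-2524). Report
`run/shared/lean/b2b/hodge-weil/b2b-hweil-pv1-g50/H2-ZERO-ONE-38.md` ([XXXVIII]). Context (the report's words, nothing of them formalised here): in the
63 residual type-1 cells whose Ω-bracket is non-negative, a (0,1) object has `X₃ ≤ 1`, where `X₃` dominates the invariant sections of `ω_Y(2S)` for every
closed Cohen–Macaulay sub-curve `Y ⊂ W′` without components in `S` ([XXXVII] SOC-OFF). LEMMA NORM: an ι-fixed integral off-S component `C′` with
`C′·S = 2β ≥ 2`, normalisation of genus `g̃` with `r` fixed points of the lifted involution and quotient genus `g₀`, contributes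
`h⁰(K_{C̃′} ⊗ ν^*𝒪(2S))⁺ = ½(g̃ − 1 + 4β − r/2) = 2β − 1 + g₀ ≥ 1`; so at most one such component, with `β = 1`, `g₀ = 0`. LEMMA NO-β1: an integral
off-S curve with `β = 1` is a theta translate `Θ_κ × {c}` (`δ·(2k) = 2` forces `k = δ = 1`; a bi-dominant one would map `C₁` onto `C₂`). PROPOSITION
FAT-THETA: the multiplicity-`m` structure `Y_h` of `W′` on `Θ_κ × {z_i}` is generically planar (the thick first neighbourhood alone gives `1 + 5 + 4 = 10`
invariant sections) and its inner ribbon has conormal quotient of degree `ℓ₁ ≥ 8` (`2(h⁰⁺ − h¹⁺) = (ℓ₁ − 5) − 3`); beyond that every layer is silent.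
LEMMA CROSS: `2χ(𝒪_Y) = τ + 2mρ`, `Σ_{j<m} ℓ_j = m(ρ + 1) + τ/2` with `ℓ_j ≥ jℓ₁` and `τ ≤ m·length(C ∩ W″)`. THEOREM THETA-CAP: `ℓ₁(m − 1) ≤ 2(ρ + 1) +
length(C ∩ W″)`; in the five `h′ = 0` cells (`ρ = 4`, `W″` = fibres of total multiplicity `≤ W′·f′ = 28`) this gives `m ≤ 5`, against the β-budget
`m = W′·S/2 = 34 + 4d₃ ≥ 74`: THEOREM H′-ZERO. The theorems below are the integer identities and inequalities behind these statements. None of them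
claims geometry. HONEST FRAMING: census work inside the ladder's H2 test ((0,1) cell) on the SPECIAL fourfold `X₀`; nothing here is a rung; no case of
the Hodge conjecture is proved; no statement of [Markman 2025] / [Perry 2026] / [EdGFS 2025] is used.
-/

-- mandated namespace `Summit.HodgeConjecture.HodgeConjecture.…` (Problem = Summit) trips `linter.dupNamespace`; the lakefile disables it
-- tree-wide (weak option), restated here so stand-alone elaboration is warning-free too.
set_option linter.dupNamespace false

namespace Summit.HodgeConjecture.HodgeConjecture.WeilTypeLadder

section ProductGroundTwentyFive

/-- **[XXXVIII] 2.1 (LEMMA NORM, the count on the normalisation).** For an involution with `r` fixed points on a smooth connected curve of genus `g̃`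
with quotient of genus `g₀`, Riemann–Hurwitz reads `2g̃ − 2 = 2(2g₀ − 2) + r`; the bundle `K_{C̃′} ⊗ ν^*𝒪(2S)` has `χ = g̃ − 1 + 4β`, `H¹ = 0` (`β ≥ 1`)
and Lefschetz number `−r/2` (characters `(−1)(+1)` at every fixed point), so `4h⁰⁺ = 2χ − r = 4(2β − 1 + g₀)`; with `r ≤ 2g̃ + 2` the value is
`≥ 2β − 1`; a value `≤ 1` with `β ≥ 1`, `g₀ ≥ 0` forces `β = 1`, `g₀ = 0`; the symmetric theta divisor (`g̃ = 2`, `r = 6`, `β = 1`) gives exactly `1`.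
[`omega`, `norm_num`] -/
theorem pg25_norm_socle :
    (∀ g g₀ r β : ℤ, 2 * g - 2 = 2 * (2 * g₀ - 2) + r → 2 * (g - 1 + 4 * β) - r = 4 * (2 * β - 1 + g₀)) ∧
    (∀ g r β : ℤ, r ≤ 2 * g + 2 → 4 * (2 * β - 1) ≤ 2 * (g - 1 + 4 * β) - r) ∧
    (∀ β g₀ : ℤ, 1 ≤ β → 0 ≤ g₀ → 2 * β - 1 + g₀ ≤ 1 → β = 1 ∧ g₀ = 0) ∧
    ((2 : ℤ) * (2 - 1 + 4 * 1) - 6 = 4 * 1) := by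
  refine ⟨fun g g₀ r β h => by omega, fun g r β h => by omega, fun β g₀ hβ hg h => by omega, by norm_num⟩

/-- **[XXXVIII] 2.2 (LEMMA NO-β1).** An integral curve `C′ ⊂ H = B₁ × C₂` off `S` with `C′·S = 2β = 2` projects onto a curve `D̄ ≡ kθ₁` of `B₁`
(`k ≥ 1`, `D̄·Θ = 2k`) with covering degree `δ ≥ 1` and `δ·(2k) = C′·S = 2`: hence `k = δ = 1` — `D̄` is a theta translate and `C′ → D̄` is
birational (then `C′` dominating `C₂` would give a non-constant map `C₁ → C₂`, excluded for the very general pair, so `C′ = D̄ × {c}`). [`omega`] -/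
theorem pg25_no_beta_one : ∀ k δ : ℕ, 1 ≤ k → 1 ≤ δ → δ * (2 * k) = 2 → k = 1 ∧ δ = 1 := by
  intro k δ hk hδ h
  have h2 : 2 * k ≤ 2 := by
    calc 2 * k = 1 * (2 * k) := by ring
      _ ≤ δ * (2 * k) := Nat.mul_le_mul_right _ hδ
      _ = 2 := h
  have hk1 : k = 1 := by omega
  subst hk1
  constructor
  · rfl
  · omega

/-- **[XXXVIII] 3.1 (PROPOSITION FAT-THETA, the layer counts on `C = Θ_κ × {z_i}`).** Equivariant Riemann–Roch on the genus-2 curve with six fixed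
points: `2(h⁰⁺ − h¹⁺) = χ + L`, `L = ½Σ_w c_w`. (a) THICK: the first neighbourhood `C^{(1)}` has pieces `𝒪_C(−2S)` (`χ = −5`, `L = +3`),
`K^{−3}[x̃_κ]` (`χ = −7`, `L = −3`), `K^{−2}[t]` (`χ = −5`, `L = −3`), all with `h⁰ = 0`: invariant `H¹` of dimensions `1`, `5`, `4`, total `10`.
(b) RIBBON: the conormal quotient `L₁` (degree `ℓ₁`, character `−1` at the six points) gives `L₁(−2S)` with `χ = ℓ₁ − 5`, `L = −3`:
`2(h⁰⁺ − h¹⁺) = ℓ₁ − 8`, so `h¹⁺ = 0` (forced by `X₃ ≤ 1`) and `h⁰⁺ ≥ 0` give `ℓ₁ ≥ 8`, and `ℓ₁` is even. (c) SILENCE: with `ℓ₁ ≥ 8` every layer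
`L_j(−2S)`, `j ≥ 1`, has degree `≥ jℓ₁ − 4 ≥ 3 = 2g − 1`, so `H¹ = 0`. [`norm_num`, `omega`, `nlinarith`] -/
theorem pg25_fat_theta_layers :
    (((-5 : ℤ) + 3 = 2 * (0 - 1)) ∧ ((-7 : ℤ) + (-3) = 2 * (0 - 5)) ∧ ((-5 : ℤ) + (-3) = 2 * (0 - 4)) ∧ ((1 : ℤ) + 5 + 4 = 10)) ∧
    (∀ ℓ₁ h0 h1 : ℤ, 2 * (h0 - h1) = (ℓ₁ - 5) + (-3) → 0 ≤ h0 → h1 = 0 → 8 ≤ ℓ₁ ∧ ℓ₁ % 2 = 0) ∧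
    (∀ ℓ₁ j : ℤ, 8 ≤ ℓ₁ → 1 ≤ j → 3 ≤ j * ℓ₁ - 4) := by
  refine ⟨by norm_num, fun ℓ₁ h0 h1 h hh0 hh1 => by omega, ?_⟩
  intro ℓ₁ j hℓ hj
  nlinarith

/-- **[XXXVIII] 3.2 (LEMMA CROSS, superadditive layers).** For the Bănică–Forster layers `L_j` of a generically planar structure the degrees satisfy
`ℓ_0 = 0` and `ℓ_i + ℓ_j ≤ ℓ_{i+j}` (the multiplication `L_i ⊗ L_j → L_{i+j}` is an injection of line bundles); hence `ℓ_j ≥ jℓ₁` and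
`2Σ_{j<m} ℓ_j ≥ ℓ₁·m(m − 1)`. [induction, `Finset.sum_range_succ`, `linarith`] -/
theorem pg25_superadditive_sum (ℓ : ℕ → ℤ) (h0 : ℓ 0 = 0) (hadd : ∀ i j : ℕ, ℓ i + ℓ j ≤ ℓ (i + j)) :
    (∀ j : ℕ, (j : ℤ) * ℓ 1 ≤ ℓ j) ∧ (∀ m : ℕ, ℓ 1 * ((m : ℤ) * ((m : ℤ) - 1)) ≤ 2 * ∑ j ∈ Finset.range m, ℓ j) := by
  have step : ∀ j : ℕ, (j : ℤ) * ℓ 1 ≤ ℓ j := by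
    intro j
    induction j with
    | zero => simp [h0]
    | succ n ih =>
      have h := hadd n 1
      rw [Nat.cast_succ, add_mul, one_mul]
      linarith
  refine ⟨step, ?_⟩
  intro m
  induction m with
  | zero => simp
  | succ n ih =>
    rw [Finset.sum_range_succ]
    have hs := step n
    have e : ℓ 1 * (((n + 1 : ℕ) : ℤ) * (((n + 1 : ℕ) : ℤ) - 1)) = ℓ 1 * ((n : ℤ) * ((n : ℤ) - 1)) + 2 * ((n : ℤ) * ℓ 1) := by
      push_cast
      ring
    rw [e]
    linarith

/-- **[XXXVIII] 3.3 (LEMMA CROSS, the Euler characteristic of a primary component).** For a primary component `Y` (multiplicity `m` on the reduced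
curve `C`) of the l.c.i. curve `W′` with `ω_{W′} ≅ Ω|_{W′}`: `ω_Y = I_T·Ω|_Y` with cokernel of length `τ = length(Y ∩ W″)` ([XXXVI] GRAPH-LINE (e)),
so `χ(ω_Y) = (m(Ω·C) + χ(𝒪_Y)) − τ` and `χ(ω_Y) = −χ(𝒪_Y)`: `2χ(𝒪_Y) = τ − m(Ω·C)`; for `C = Θ_κ × {z_i}` (or an S-line) `Ω·C = (n′ − 2n₃)·2 +
(6 − 2d₃)·0 = −2ρ`, so `2χ(𝒪_Y) = τ + 2mρ`, and on the genus-2 curve `Σ_{j<m} ℓ_j = χ(𝒪_Y) + m = m(ρ + 1) + τ/2`. [`nlinarith`, `ring`] -/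
theorem pg25_cross_identity :
    (∀ χ τ m ρ ΩC : ℤ, -χ = (m * ΩC + χ) - τ → ΩC = -2 * ρ → 2 * χ = τ + 2 * (m * ρ)) ∧
    (∀ n' n₃ d₃ : ℤ, (n' - 2 * n₃) * 2 + (6 - 2 * d₃) * 0 = -2 * (2 * n₃ - n')) ∧
    (∀ χ m S : ℤ, S - m = χ → S = χ + m) := by
  refine ⟨?_, fun n' n₃ d₃ => by ring, fun χ m S h => by omega⟩
  intro χ τ m ρ ΩC h hΩ
  subst hΩ
  nlinarith

/-- **[XXXVIII] 3.4 (THEOREM THETA-CAP).** With `2Σℓ_j = 2m(ρ + 1) + τ`, `2Σℓ_j ≥ ℓ₁·m(m − 1)`, `τ ≤ m·Λ` (`Λ := length(C ∩ W″)`) and `m ≥ 1`: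
`ℓ₁(m − 1) ≤ 2(ρ + 1) + Λ`. In the five `h′ = 0` cells (`ρ = 4`, `ℓ₁ ≥ 8`, `Λ ≤ W′·f′ = 28`): `8(m − 1) ≤ 38`, i.e. `m ≤ 5`; in all 45 cells
(`Λ ≤ 28 + 2(34 + 4d₃ − m)`): `10m ≤ 114 + 8d₃`, `m ≤ 22`; and `24 + 4d₃` (the β-budget reading of [XXXVII] 12.2 (d)) always exceeds that cap.
[`le_of_mul_le_mul_left`, `nlinarith`, `omega`] -/
theorem pg25_theta_cap :
    (∀ m ρ τ Λ ℓ₁ S2 : ℤ, 1 ≤ m → S2 = 2 * m * (ρ + 1) + τ → ℓ₁ * (m * (m - 1)) ≤ S2 → τ ≤ m * Λ →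
      ℓ₁ * (m - 1) ≤ 2 * (ρ + 1) + Λ) ∧
    (∀ m τ S2 : ℤ, 1 ≤ m → S2 = 2 * m * (4 + 1) + τ → 8 * (m * (m - 1)) ≤ S2 → τ ≤ m * 28 → m ≤ 5) ∧
    (∀ d₃ m : ℤ, 4 ≤ d₃ → d₃ ≤ 14 → 1 ≤ m → 8 * (m - 1) ≤ 2 * (4 + 1) + (28 + 2 * (34 + 4 * d₃ - m)) → m ≤ 22) ∧
    (∀ d₃ : ℤ, 0 ≤ d₃ → 114 + 8 * d₃ < 10 * (24 + 4 * d₃)) := by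
  refine ⟨?_, ?_, fun d₃ m h4 h14 hm h => by omega, fun d₃ h => by omega⟩
  · intro m ρ τ Λ ℓ₁ S2 hm hS hℓ hτ
    have key : m * (ℓ₁ * (m - 1)) ≤ m * (2 * (ρ + 1) + Λ) := by nlinarith
    exact le_of_mul_le_mul_left key (by omega)
  · intro m τ S2 hm hS h8 hτ
    by_contra hc
    have h6 : 6 ≤ m := by omega
    nlinarith

/-- **[XXXVIII] 4.1 (THEOREM H′-ZERO: the five cells `(7, d₃, 21, d₃)`, `d₃ = 10, …, 14`).** Type 1, `n₃ = 7` (`ρ = 4`): `W′·f′ = 70 − 2·7·3 = 28`,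
`W′·S/2 = 62 − 7(4 − d₃) − 3d₃ = 34 + 4d₃`; with `h′ = 0` every S-component is a vertical fibre (`β = 0`) and the off-S skeleton is fixed fibres plus
one theta-translate structure of multiplicity `m_h` (NORM, NO-β1, SOC-OFF), so the β-budget reads `m_h = 34 + 4d₃ ∈ [74, 90]`, while THETA-CAP gives
`m_h ≤ 5`: contradiction. Of the 6 two-torsion points on `Θ_κ`, `2` lie on `Θ` and `4` do not. [`omega`, `norm_num`] -/
theorem pg25_h_prime_zero_void :
    ((70 : ℤ) - 2 * 7 * 3 = 28) ∧ (∀ d₃ : ℤ, 62 - 7 * (4 - d₃) - 3 * d₃ = 34 + 4 * d₃) ∧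
    (∀ d₃ m : ℤ, 10 ≤ d₃ → d₃ ≤ 14 → m = 34 + 4 * d₃ → 74 ≤ m ∧ m ≤ 90) ∧
    (∀ d₃ m : ℤ, 10 ≤ d₃ → m = 34 + 4 * d₃ → m ≤ 5 → False) ∧ ((6 : ℕ) - 2 = 4) := by
  refine ⟨by norm_num, fun d₃ => by omega, fun d₃ m h1 h2 h3 => by omega, fun d₃ m h1 h2 h3 => by omega, by norm_num⟩

/-- **[XXXVIII] 4.2 (the residual count and the load on S).** Type 1: the 65 residual cells lose the five `h′ = 0` cells: `65 − 5 = 60 = 17 + 40 + 3`.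
In the other 40 cells `(7, d₃, 21, a₂)`, `4 ≤ d₃ < a₂ ≤ 14`, the S-lines and bi-dominant S-curves must carry β-mass `34 + 4d₃ − m_h ≥ 29 + 4d₃ ≥ 45`
on `h′ = a₂ − d₃ ≤ 10` units of `D′` when no S-component of positive β passes through the two points `(Θ_κ ∩ Θ) × {z_i}` (then `m_h ≤ 5`): average
`x̃`-block size `> 4`. [`omega`] -/
theorem pg25_residual_and_load :
    ((65 : ℕ) - 5 = 60 ∧ (17 : ℕ) + 40 + 3 = 60) ∧
    (∀ d₃ a₂ mh : ℤ, 4 ≤ d₃ → d₃ < a₂ → a₂ ≤ 14 → mh ≤ 5 → 45 ≤ 34 + 4 * d₃ - mh ∧ a₂ - d₃ ≤ 10 ∧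
      4 * (a₂ - d₃) < 34 + 4 * d₃ - mh) := by
  refine ⟨by norm_num, fun d₃ a₂ mh h1 h2 h3 h4 => by omega⟩

end ProductGroundTwentyFive

end Summit.HodgeConjecture.HodgeConjecture.WeilTypeLadder
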